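import Summits.HubbardSuperconductivity.HubbardSuperconductivity.Theorems.KacWindowPenaltyWindowGapPenalisedForms
import Summits.HubbardSuperconductivity.HubbardSuperconductivity.Theorems.BalabanIRBirGroundStateAverageLRO
import Summits.HubbardSuperconductivity.HubbardSuperconductivity.Theorems.WindowGap.Negative.TwistCeilingWeights
import Summits.HubbardSuperconductivity.HubbardSuperconductivity.Theorems.WindowGap.Negative.PairModesAtMomentum

/-!
# Crux `WindowGap` (stmt-HubbardSuperconductivity-1088): the `U = 0` calibration — the free Fermi gas
# has flat window pair weight, so the crux body fails at the free point

Negative-side support for the crux `KacWindowPenalty.WindowGap` (route `KacWindowPenalty`), target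
(T3) of the crux notes (`Cruxes/WindowGap/NOTES.md` §6: "U = 0 calibration of Φ(ε,λ): Wick, expect
κε², crux false at the free point for C > κ") made a theorem. Nothing here asserts a Theses decl
positively; the crux (`∃ U > 0 …`) is untouched — this pins the role of the interaction.

* (sibling file `PairModesAtMomentum.lean`) for a Hermitian idempotent `P` commuting with every Bloch
  occupation number `n_{kσ}` and EVERY pair momentum `m`: `Re tr (P Δ_d(m)ᴴ Δ_d(m)) ≤ 50 L² Re tr P`
  (`re_trace_mul_conjTranspose_pairFieldAt_dWave_mul_le`; flat pair structure factor).
* `re_trace_sectorEigenProj_mul_kacWindow_le_free` — at `U = 0` (`L ≥ 3`) the projection onto any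
  joint sector eigenspace commutes with every `n_{kσ}` (tree:
  `projMatrix_sectorEigenspace_free_commute_momentumNumber`), so the crux's Kac-window penalty obeys
  `Re tr (P W_ε) ≤ 50 · #{m : |q_m| ≤ ε} · Re tr P`; `card_window_le`: `#window ≤ (2⌊εL/2π⌋ + 1)²`.
* `not_windowGapAt_zero` — **the body of `WindowGap` with `U := 0` is false for every filling
  `δ ≥ −1` (so for every `δ ∈ (0, 1/2)`)**: the gap would force `(Cε + a)L² ≤ Re ⟨ψ, W_ε ψ⟩` on every normalised sector
  ground state (`windowWeight_of_windowGapAt`), hence `(Cε + a)L² tr P ≤ Re tr (P W_ε)` on the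
  ground eigen-projection (`mul_re_trace_projMatrix_map_le`), against the flat bound above: with the
  adversarial tail allowance `C = 6 ≥ 50/π²` and `ε₀ = 1` this leaves `aL² ≤ 100L/π + 50`, absurd.
  So `0 < U` is load-bearing in the crux exactly as the metallic `κε²` law predicts (disprover
  numerics j015079, κ ≤ 0.22, for the sibling crux 1089): at the free point the window carries only
  the flat `O(ε²)` pair-fluctuation weight, which no `λ, a > 0` can turn into an extensive excess.

Sources: J. Bardeen, L. N. Cooper, J. R. Schrieffer, Phys. Rev. 108 (1957) 1175, §II (pair
correlations of the normal Fermi sea are `O(1)` per mode); C. N. Yang, Rev. Mod. Phys. 34 (1962)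
694, §3 (no ODLRO for free fermions); D. J. Scalapino, Phys. Rep. 250 (1995) 329, §2 (the
`d_{x²−y²}` pair field). Folklore finite-dimensional statements; no named facts, no definitions.
-/

set_option linter.dupNamespace false

noncomputable section

namespace Summit.HubbardSuperconductivity.HubbardSuperconductivity.Theorems.WindowGap.Negative

open Matrix Finset Literature.MathematicalPhysics.QuantumLattice Literature.Probability.LatticeModels
open scoped ComplexOrder ComplexConjugate

variable {L : ℕ} [NeZero L]

/-! ### The free torus: the window operator against sector eigen-projections -/

/-- **The Kac-window weight of the free Fermi gas is `O(1)` per window mode.** At `U = 0` (`L ≥ 3`),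
for any `(N, S^z = M)`, any `e` and `P` the orthogonal projection onto the joint sector eigenspace
`szSector N M ⊓ ker (H(1,0) − e)`: `Re tr (P W_ε) ≤ 50 · #{m : |q_m| ≤ ε} · Re tr P`, where
`W_ε = L⁻² Σ_{|q_m| ≤ ε} Δ_d(m)ᴴ Δ_d(m)` is the crux's Kac-window pair penalty (each window mode
contributes `L⁻² Re tr (P Δ_d(m)ᴴΔ_d(m)) ≤ 50 Re tr P` by
`re_trace_mul_conjTranspose_pairFieldAt_dWave_mul_le`; `P` commutes with every `n_{kσ}`,
`projMatrix_sectorEigenspace_free_commute_momentumNumber`). Bardeen–Cooper–Schrieffer (1957) §II.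
[folklore] -/
theorem re_trace_sectorEigenProj_mul_kacWindow_le_free (hL : 3 ≤ L) (N : ℕ) (M : ℝ) (e : ℂ)
    (ε : ℝ) :
    let E := szSector (Λ := FermionTorus 2 L) N M ⊓
      Module.End.eigenspace (Matrix.toLin' (hubbardTorus 2 L 1 0)) e
    let P := projMatrix (E.map
      ((WithLp.linearEquiv 2 ℂ (Finset (Orb (FermionTorus 2 L)) → ℂ)).symm :
        (Finset (Orb (FermionTorus 2 L)) → ℂ) →ₗ[ℂ] EuclideanSpace ℂ (Finset (Orb (FermionTorus 2 L)))))
    (P * (∑ m : Fin 2 → ZMod L,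
        if (2 * Real.pi / (L : ℝ)) ^ 2 * (∑ i : Fin 2, (((m i).valMinAbs : ℤ) : ℝ) ^ 2) ≤ ε ^ 2 then
          ((L : ℂ) ^ 2)⁻¹ • (Matrix.conjTranspose (pairFieldAt dWaveFormFactor L m) *
            pairFieldAt dWaveFormFactor L m)
        else 0)).trace.re ≤
      50 * ((Finset.univ.filter fun m : Fin 2 → ZMod L =>
        (2 * Real.pi / (L : ℝ)) ^ 2 * (∑ i : Fin 2, (((m i).valMinAbs : ℤ) : ℝ) ^ 2) ≤ ε ^ 2).card : ℝ) *
        P.trace.re := by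
  intro E P
  have hPh : Pᴴ = P := (projMatrix_isHermitian _).eq
  have hPP : P * P = P := projMatrix_mul_self _
  have hPc : ∀ (k : TorusSite 2 L) (σ : Fin 2), Commute P (momentumNumber k σ) :=
    fun k σ => projMatrix_sectorEigenspace_free_commute_momentumNumber hL N M e k σ
  have hLpos : (0 : ℝ) < (L : ℝ) := Nat.cast_pos.2 (Nat.pos_of_ne_zero (NeZero.ne L))
  have hL2 : (0 : ℝ) < (L : ℝ) ^ 2 := by positivity
  have hc : ((L : ℂ) ^ 2)⁻¹ = ((((L : ℝ) ^ 2)⁻¹ : ℝ) : ℂ) := by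
    rw [Complex.ofReal_inv, Complex.ofReal_pow, Complex.ofReal_natCast]
  rw [Matrix.mul_sum, trace_sum, Complex.re_sum]
  have hterm : ∀ m : Fin 2 → ZMod L,
      (P * (if (2 * Real.pi / (L : ℝ)) ^ 2 * (∑ i : Fin 2, (((m i).valMinAbs : ℤ) : ℝ) ^ 2) ≤ ε ^ 2
        then ((L : ℂ) ^ 2)⁻¹ • (Matrix.conjTranspose (pairFieldAt dWaveFormFactor L m) *
          pairFieldAt dWaveFormFactor L m) else 0)).trace.re ≤
      if (2 * Real.pi / (L : ℝ)) ^ 2 * (∑ i : Fin 2, (((m i).valMinAbs : ℤ) : ℝ) ^ 2) ≤ ε ^ 2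
        then 50 * P.trace.re else 0 := by
    intro m
    split_ifs with hm
    · rw [hc, Matrix.mul_smul, trace_smul, smul_eq_mul, Complex.re_ofReal_mul]
      have h := re_trace_mul_conjTranspose_pairFieldAt_dWave_mul_le hPh hPP hPc m
      calc ((L : ℝ) ^ 2)⁻¹ * (P * ((pairFieldAt dWaveFormFactor L m)ᴴ *
            pairFieldAt dWaveFormFactor L m)).trace.re
          ≤ ((L : ℝ) ^ 2)⁻¹ * (50 * (L : ℝ) ^ 2 * P.trace.re) :=
            mul_le_mul_of_nonneg_left h (by positivity)
        _ = 50 * P.trace.re := by field_simp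
    · rw [Matrix.mul_zero, trace_zero, Complex.zero_re]
  refine (Finset.sum_le_sum fun m _ => hterm m).trans ?_
  rw [Finset.sum_ite, Finset.sum_const_zero, add_zero, Finset.sum_const, nsmul_eq_mul]
  ring_nf
  rfl

/-! ### Counting the window -/

/-- Each coordinate of a window momentum label is small: `|valMinAbs mᵢ| ≤ ⌊εL/2π⌋`. [folklore] -/
theorem natAbs_valMinAbs_le_floor_of_window' {ε : ℝ} (hε : 0 ≤ ε) {m : TorusSite 2 L}
    (hm : (2 * Real.pi / (L : ℝ)) ^ 2 * (∑ i : Fin 2, (((m i).valMinAbs : ℤ) : ℝ) ^ 2) ≤ ε ^ 2)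
    (i : Fin 2) : (m i).valMinAbs.natAbs ≤ ⌊ε * L / (2 * Real.pi)⌋₊ := by
  have hL : (0 : ℝ) < L := Nat.cast_pos.2 (Nat.pos_of_ne_zero (NeZero.ne L))
  have h0 : (((m i).valMinAbs : ℤ) : ℝ) ^ 2 ≤ ∑ j : Fin 2, (((m j).valMinAbs : ℤ) : ℝ) ^ 2 :=
    Finset.single_le_sum (f := fun j : Fin 2 => (((m j).valMinAbs : ℤ) : ℝ) ^ 2)
      (fun j _ => sq_nonneg _) (Finset.mem_univ i)
  have h1 : (2 * Real.pi / L * |(((m i).valMinAbs : ℤ) : ℝ)|) ^ 2 ≤ ε ^ 2 := by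
    rw [mul_pow, sq_abs]
    exact (mul_le_mul_of_nonneg_left h0 (sq_nonneg _)).trans hm
  have h2 : 2 * Real.pi / L * |(((m i).valMinAbs : ℤ) : ℝ)| ≤ ε :=
    le_of_pow_le_pow_left₀ two_ne_zero hε h1
  have h3 : |(((m i).valMinAbs : ℤ) : ℝ)| ≤ ε * L / (2 * Real.pi) := by
    rw [le_div_iff₀ (by positivity)]
    have h4 : 2 * Real.pi / L * |(((m i).valMinAbs : ℤ) : ℝ)| * L ≤ ε * L :=
      mul_le_mul_of_nonneg_right h2 hL.le
    calc |(((m i).valMinAbs : ℤ) : ℝ)| * (2 * Real.pi)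
        = 2 * Real.pi / L * |(((m i).valMinAbs : ℤ) : ℝ)| * L := by field_simp
      _ ≤ ε * L := h4
  refine Nat.le_floor ?_
  rw [Nat.cast_natAbs, Int.cast_abs]
  exact h3

/-- **Window count**: `#{m ∈ (ℤ/L)² : |q_m| ≤ ε} ≤ (2⌊εL/2π⌋ + 1)²` (inject by the centred
representatives `valMinAbs` into the square `[−J, J]²`, `J = ⌊εL/2π⌋`). [folklore] -/
theorem card_window_le {ε : ℝ} (hε : 0 ≤ ε) :
    (Finset.univ.filter fun m : Fin 2 → ZMod L =>
        (2 * Real.pi / (L : ℝ)) ^ 2 * (∑ i : Fin 2, (((m i).valMinAbs : ℤ) : ℝ) ^ 2) ≤ ε ^ 2).card ≤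
      (2 * ⌊ε * L / (2 * Real.pi)⌋₊ + 1) ^ 2 := by
  classical
  set J : ℕ := ⌊ε * L / (2 * Real.pi)⌋₊ with hJ
  set f : (Fin 2 → ZMod L) → ℤ × ℤ := fun m => ((m 0).valMinAbs, (m 1).valMinAbs) with hf
  have hinj : Function.Injective f := by
    intro m m' h
    simp only [hf, Prod.mk.injEq] at h
    funext i
    fin_cases i
    · exact ZMod.valMinAbs_inj.1 h.1
    · exact ZMod.valMinAbs_inj.1 h.2
  have hmaps : ∀ m ∈ (Finset.univ.filter fun m : Fin 2 → ZMod L =>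
      (2 * Real.pi / (L : ℝ)) ^ 2 * (∑ i : Fin 2, (((m i).valMinAbs : ℤ) : ℝ) ^ 2) ≤ ε ^ 2),
      f m ∈ (Finset.Icc (-(J : ℤ)) J) ×ˢ (Finset.Icc (-(J : ℤ)) J) := by
    intro m hm
    rw [Finset.mem_filter] at hm
    have hb := fun i => natAbs_valMinAbs_le_floor_of_window' hε hm.2 i
    simp only [hf, Finset.mem_product, Finset.mem_Icc]
    have h0 := hb 0
    have h1 := hb 1
    rw [← hJ] at h0 h1
    refine ⟨⟨?_, ?_⟩, ?_, ?_⟩ <;> omega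
  calc (Finset.univ.filter fun m : Fin 2 → ZMod L =>
        (2 * Real.pi / (L : ℝ)) ^ 2 * (∑ i : Fin 2, (((m i).valMinAbs : ℤ) : ℝ) ^ 2) ≤ ε ^ 2).card
      ≤ ((Finset.Icc (-(J : ℤ)) J) ×ˢ (Finset.Icc (-(J : ℤ)) J)).card :=
        Finset.card_le_card_of_injOn f hmaps (hinj.injOn)
    _ = (2 * J + 1) ^ 2 := by
        rw [Finset.card_product, Int.card_Icc]
        have : ((J : ℤ) + 1 - -(J : ℤ)).toNat = 2 * J + 1 := by omega
        rw [this]; ring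

/-! ### The calibration: the crux body fails at the free point -/

/-- **The body of `WindowGap` is FALSE at the free point `U = 0`, for every filling (`δ ≥ −1`, in
particular every `δ ∈ (0, 1/2)`).**
Here the body is the crux `KacWindowPenalty.WindowGap` with its leading `∃ U > 0, ∃ δ` stripped and
`U := 0` (Kac window `W_ε` spelled with `pairFieldAt`, `rfl`-equal to the crux's `let D`/`let W`).
Mechanism: the gap forces `(Cε + a)L² ≤ Re ⟨ψ, W_ε ψ⟩` on EVERY normalised sector ground state
(`windowWeight_of_windowGapAt`), hence on the whole ground eigenspace `K` of the free torus in the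
sector, so `(Cε + a)L² · tr P_K ≤ Re tr (P_K W_ε)` (`mul_re_trace_projMatrix_map_le`); but `P_K`
commutes with every Bloch occupation number, so `Re tr (P_K W_ε) ≤ 50 · #window · tr P_K ≤
50 (εL/π + 1)² tr P_K` (`re_trace_sectorEigenProj_mul_kacWindow_le_free`, `card_window_le`): the free
Fermi gas carries window pair weight `O(ε²)` per site (flat pair structure factor), which the
adversarial tail allowance `C = 6 ≥ 50/π²` absorbs for `ε ≤ ε₀ = 1`, leaving `aL² ≤ 100L/π + 50`,
absurd for large `L`. So in the crux the interaction `U > 0` is load-bearing: at `U = 0` no choice of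
`(ε, λ, a)` works, whatever `δ`. (The crux itself, `∃ U > 0 …`, is untouched.)
Bardeen–Cooper–Schrieffer (1957) §II; Yang, Rev. Mod. Phys. 34 (1962) 694, §3. [folklore] -/
theorem not_windowGapAt_zero {δ : ℝ} (hδ : -1 ≤ δ) :
    ¬ (∀ C : ℝ, 0 ≤ C → ∀ ε₀ : ℝ, 0 < ε₀ → ∃ ε ∈ Set.Ioc (0 : ℝ) ε₀, ∃ lam a : ℝ, 0 < lam ∧ 0 < a ∧
      ∃ L₀ : ℕ, ∀ (L : ℕ) [NeZero L], L₀ ≤ L → Even L →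
        lam * (C * ε + a) * (L : ℝ) ^ 2 ≤
          (hubbardTorus 2 L 1 0 + (lam : ℂ) • (∑ m : Fin 2 → ZMod L,
              if (2 * Real.pi / (L : ℝ)) ^ 2 * (∑ i : Fin 2, (((m i).valMinAbs : ℤ) : ℝ) ^ 2) ≤ ε ^ 2
              then ((L : ℂ) ^ 2)⁻¹ • (Matrix.conjTranspose (pairFieldAt dWaveFormFactor L m) *
                pairFieldAt dWaveFormFactor L m)
              else 0)).minEnergyOn (szSector (2 * ⌊(1 - δ) * (L : ℝ) ^ 2 / 2⌋₊) 0) -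
            (hubbardTorus 2 L 1 0).minEnergyOn (szSector (2 * ⌊(1 - δ) * (L : ℝ) ^ 2 / 2⌋₊) 0)) := by
  classical
  intro h
  obtain ⟨ε, hε, lam, a, hlam, ha, L₀, hL⟩ := h 6 (by norm_num) 1 one_pos
  have hπ : 3 < Real.pi := Real.pi_gt_three
  have hπ0 : 0 < Real.pi := Real.pi_pos
  -- the side `L`: even, `≥ L₀`, `≥ 3`, and with `a·L > X := 100/π + 50`
  set X : ℝ := 100 / Real.pi + 50 with hX
  have hXpos : 0 < X := by rw [hX]; positivity
  set T : ℕ := max (max L₀ 3) (⌈X / a⌉₊ + 1) with hT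
  set L : ℕ := 2 * T with hLdef
  have hTL : T ≤ L := by omega
  have hL₀ : L₀ ≤ L := le_trans ((le_max_left _ _).trans (le_max_left _ _)) hTL
  have hL3 : 3 ≤ L := le_trans ((le_max_right _ _).trans (le_max_left _ _)) hTL
  have hE : Even L := ⟨T, by omega⟩
  haveI : NeZero L := ⟨by omega⟩
  have hLreal : (3 : ℝ) ≤ (L : ℝ) := by exact_mod_cast hL3
  have haL : X < a * (L : ℝ) := by
    have h1 : X / a ≤ (⌈X / a⌉₊ : ℝ) := Nat.le_ceil _
    have h2 : (⌈X / a⌉₊ : ℝ) + 1 ≤ (T : ℝ) := by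
      have : ⌈X / a⌉₊ + 1 ≤ T := le_max_right _ _
      exact_mod_cast this
    have h3 : (T : ℝ) ≤ (L : ℝ) := by exact_mod_cast hTL
    have h4 : X / a < (L : ℝ) := by linarith only [h1, h2, h3]
    rwa [div_lt_iff₀ ha, mul_comm] at h4
  have hgap := hL L hL₀ hE
  -- filling
  set n : ℕ := ⌊(1 - δ) * (L : ℝ) ^ 2 / 2⌋₊ with hn
  have hnL : n ≤ L ^ 2 := Summit.HubbardSuperconductivity.NoGo.floor_pairNumber_le δ hδ L
  -- the window operator and the ground eigenspace
  set W : Matrix (Finset (Orb (FermionTorus 2 L))) (Finset (Orb (FermionTorus 2 L))) ℂ :=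
    ∑ m : Fin 2 → ZMod L,
      if (2 * Real.pi / (L : ℝ)) ^ 2 * (∑ i : Fin 2, (((m i).valMinAbs : ℤ) : ℝ) ^ 2) ≤ ε ^ 2
      then ((L : ℂ) ^ 2)⁻¹ • (Matrix.conjTranspose (pairFieldAt dWaveFormFactor L m) *
        pairFieldAt dWaveFormFactor L m)
      else 0 with hWdef
  set H := hubbardTorus 2 L 1 0 with hHdef
  set K : Submodule ℂ (Fock (Orb (FermionTorus 2 L))) := szSector (2 * n) 0 ⊓
    Module.End.eigenspace (Matrix.toLin' H) ((H.minEnergyOn (szSector (2 * n) 0) : ℝ) : ℂ) with hKdef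
  -- unit vectors of `K` are normalised sector ground states: they carry the window weight
  have hKw : ∀ ψ ∈ K, star ψ ⬝ᵥ ψ = 1 → (6 * ε + a) * (L : ℝ) ^ 2 ≤ (star ψ ⬝ᵥ W *ᵥ ψ).re := by
    intro ψ hψK hψ1
    rw [hKdef, Submodule.mem_inf, Module.End.mem_eigenspace_iff, Matrix.toLin'_apply] at hψK
    have hψ0 : ψ ≠ 0 := by
      rintro rfl
      simp at hψ1
    have hgs : IsGroundStateInSector H (2 * n) 0 ψ := ⟨hψK.1, hψ0, hψK.2⟩
    have hgap' : lam * ((6 * ε + a) * (L : ℝ) ^ 2) ≤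
        (H + (lam : ℂ) • W).minEnergyOn (szSector (2 * n) 0) - H.minEnergyOn (szSector (2 * n) 0) := by
      rw [← mul_assoc]; exact hgap
    exact windowWeight_of_windowGapAt L 0 (2 * n) hlam hgap' hψ1 hgs
  -- `K ≠ ⊥`
  obtain ⟨ψ₀, hψ₀, hψ₀gs⟩ :=
    Summit.HubbardSuperconductivity.NoGo.exists_unit_groundStateInSector_hubbardTorus L 1 0 hnL
  have hK0 : K ≠ ⊥ := by
    intro hbot
    have hmem : ψ₀ ∈ K := by
      rw [hKdef, Submodule.mem_inf, Module.End.mem_eigenspace_iff, Matrix.toLin'_apply]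
      exact ⟨hψ₀gs.1, hψ₀gs.2.2⟩
    rw [hbot, Submodule.mem_bot] at hmem
    exact hψ₀gs.2.1 hmem
  -- the trace sandwich
  have hlow := mul_re_trace_projMatrix_map_le K W ((6 * ε + a) * (L : ℝ) ^ 2) hKw
  have hup := re_trace_sectorEigenProj_mul_kacWindow_le_free hL3 (2 * n) 0
    ((H.minEnergyOn (szSector (2 * n) 0) : ℝ) : ℂ) ε
  simp only [] at hup
  have htr := one_le_re_trace_projMatrix_map K hK0
  have hcard := card_window_le (L := L) hε.1.le
  have hmain := le_of_mul_le_mul_right (hlow.trans hup) (by linarith only [htr])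
  -- the count: `#window ≤ (2J+1)² ≤ (εL/π + 1)²`
  have hε1 : ε ≤ 1 := hε.2
  have hε0 : 0 < ε := hε.1
  have hc' := (Nat.cast_le (α := ℝ)).2 hcard
  push_cast at hc'
  have hJle : (⌊ε * L / (2 * Real.pi)⌋₊ : ℝ) ≤ ε * L / (2 * Real.pi) :=
    Nat.floor_le (div_nonneg (mul_nonneg hε0.le (Nat.cast_nonneg _)) (by positivity))
  have hJ' : 2 * (⌊ε * L / (2 * Real.pi)⌋₊ : ℝ) + 1 ≤ ε * L / Real.pi + 1 := by
    have : 2 * (ε * L / (2 * Real.pi)) = ε * L / Real.pi := by field_simp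
    linarith only [hJle, this]
  have hc'' := hc'.trans (pow_le_pow_left₀ (by positivity) hJ' 2)
  -- arithmetic endgame
  have hq : ε * L / Real.pi = ε * L * Real.pi⁻¹ := div_eq_mul_inv _ _
  have hinv : Real.pi⁻¹ < 1 / 3 := by
    rw [inv_eq_one_div]; exact one_div_lt_one_div_of_lt (by norm_num) hπ
  have hinv0 : 0 < Real.pi⁻¹ := inv_pos.2 hπ0
  have hinv2 : Real.pi⁻¹ * Real.pi⁻¹ ≤ 1 / 9 := by
    have := mul_lt_mul'' hinv hinv hinv0.le hinv0.le
    linarith only [this]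
  -- 50 (εL/π + 1)² = 50 ε² L² π⁻² + 100 ε L π⁻¹ + 50, and 50 ε² π⁻² ≤ (50/9) ε < 6 ε
  have hkey : 50 * (ε * L / Real.pi + 1) ^ 2 ≤ 6 * ε * (L : ℝ) ^ 2 + 100 * Real.pi⁻¹ * L + 50 := by
    rw [hq]
    have h1 : ε * ε ≤ ε := by nlinarith only [hε0, hε1]
    have hL2 : (0 : ℝ) ≤ (L : ℝ) ^ 2 := by positivity
    have hL1 : (0 : ℝ) ≤ (L : ℝ) := Nat.cast_nonneg _
    have h3 : 50 * (ε * ε) * (Real.pi⁻¹ * Real.pi⁻¹) ≤ 6 * ε := by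
      calc 50 * (ε * ε) * (Real.pi⁻¹ * Real.pi⁻¹) ≤ 50 * ε * (1 / 9) := by
            have := mul_le_mul h1 hinv2 (by positivity) hε0.le
            linarith only [this]
        _ ≤ 6 * ε := by linarith only [hε0]
    have h4 : 100 * (ε * ↑L * Real.pi⁻¹) ≤ 100 * Real.pi⁻¹ * L := by
      have : ε * ↑L * Real.pi⁻¹ ≤ 1 * ↑L * Real.pi⁻¹ :=
        mul_le_mul_of_nonneg_right (mul_le_mul_of_nonneg_right hε1 hL1) hinv0.le
      linarith only [this]
    have hexp : 50 * (ε * ↑L * Real.pi⁻¹ + 1) ^ 2 =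
        50 * (ε * ε) * (Real.pi⁻¹ * Real.pi⁻¹) * (L : ℝ) ^ 2 + 100 * (ε * ↑L * Real.pi⁻¹) + 50 := by
      ring
    rw [hexp]
    have h5 := mul_le_mul_of_nonneg_right h3 hL2
    linarith only [h4, h5]
  have hfin : a * (L : ℝ) ^ 2 ≤ 100 * Real.pi⁻¹ * L + 50 := by
    have h50 := mul_le_mul_of_nonneg_left hc'' (by norm_num : (0:ℝ) ≤ 50)
    linarith only [hmain, h50, hkey]
  -- but `a L² > X L = 100 L/π + 50 L ≥ 100 L/π + 50`
  have hL0 : (0 : ℝ) ≤ (L : ℝ) := Nat.cast_nonneg _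
  have hXL : X * (L : ℝ) ≤ a * (L : ℝ) ^ 2 := by
    have h1 := mul_le_mul_of_nonneg_right haL.le hL0
    have h2 : a * (L : ℝ) * (L : ℝ) = a * (L : ℝ) ^ 2 := by ring
    linarith only [h1, h2]
  have hX' : 100 * Real.pi⁻¹ * L + 50 < X * (L : ℝ) := by
    have hXexp : X * (L : ℝ) = 100 * Real.pi⁻¹ * L + 50 * L := by rw [hX]; ring
    rw [hXexp]
    linarith only [hLreal]
  linarith only [hfin, hXL, hX']

end Summit.HubbardSuperconductivity.HubbardSuperconductivity.Theorems.WindowGap.Negative
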